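import Summits.SmoothPoincare4.SmoothPoincare4.Theorems.SymplecticOrigamiFoldedSphereFoldExistenceFoldPullback

/-!
# Fold maps along a chart 3-sphere give folded symplectic forms (assembly)

Helper file for item `FoldedSphereFoldExistence` (route SymplecticOrigami): assembly of the
fold-map pull-back lemma `isFoldedForm_pullback_of_foldMap` — for a smooth `f : M → ℝ⁴` that is
regular off `Z = e(S³)` and folds along `Z` (fold normal form `(u₀², u₁, u₂, u₃)` in charts, with
`Z = {u₀ = 0}`), `f^*ω₀` is a folded symplectic form with folding hypersurface `n ↦ e n`
(Cannas da Silva 2010, §1 / Lemma 4 with the trivial foliation; Gromov 1986, §2.1.3). Transverse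
vanishing of `ω ∧ ω`: the chart Pfaffian of `f^*ω₀` is `det D(f ∘ σ⁻¹)`, which factors near the
centre as `det D(ψ⁻¹) · 2u₀ ∘ β · det Dβ` for the transition map `β = φ ∘ σ⁻¹`.
-/

noncomputable section

-- the prescribed namespace `Summit.<P>.<Sub>.…` duplicates `SmoothPoincare4` (P = Sub)
set_option linter.dupNamespace false

open scoped Manifold ContDiff Topology
open Set Function Metric Filter
open Literature.Geometry.Symplectic Literature.Geometry.Kaehler

namespace Summit.SmoothPoincare4.SmoothPoincare4.Theorems.FoldedSphereFoldExistence

variable {M : Type*} [TopologicalSpace M] [ChartedSpace (EuclideanSpace ℝ (Fin 4)) M]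
  [IsManifold (𝓡 4) ∞ M]

/-- `det (A ∘ B) = det A · det B` for continuous linear endomorphisms. [folklore] -/
theorem det_comp_clm {E : Type*} [NormedAddCommGroup E] [NormedSpace ℝ E] (A B : E →L[ℝ] E) :
    (A.comp B).det = A.det * B.det := by
  show LinearMap.det ((A : E →ₗ[ℝ] E).comp (B : E →ₗ[ℝ] E)) = _
  rw [LinearMap.det_comp]

/-! ### Transversality of the chart Pfaffian at a fold point -/

/-- **`ω ∧ ω ⋔ 0` for `ω = f^*ω₀` at a fold point.** In the preferred chart `σ` at a point `x₀`
of a fold chart `φ` with `(φ x₀)₀ = 0`, the Pfaffian of the representative of `f^*ω₀` is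
`det D(f ∘ σ⁻¹) = det D(ψ⁻¹) · (2 u₀ ∘ β) · det Dβ` near the centre (`β = φ ∘ σ⁻¹`), whose
derivative at the centre is `det D(ψ⁻¹) · det Dβ · 2 du₀ ∘ Dβ ≠ 0`. [folklore] -/
theorem fderiv_pfaffian_inChart_ne_zero_of_foldChart {f : M → EuclideanSpace ℝ (Fin 4)}
    (hf : ContMDiff (𝓡 4) (𝓡 4) ∞ f)
    {φ : OpenPartialHomeomorph M (EuclideanSpace ℝ (Fin 4))}
    {ψ : OpenPartialHomeomorph (EuclideanSpace ℝ (Fin 4)) (EuclideanSpace ℝ (Fin 4))}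
    (hφ : φ ∈ IsManifold.maximalAtlas (𝓡 4) ∞ M)
    (hψ : ψ ∈ IsManifold.maximalAtlas (𝓡 4) ∞ (EuclideanSpace ℝ (Fin 4)))
    (hsrc : φ.source ⊆ f ⁻¹' ψ.source)
    (hnf : ∀ x ∈ φ.source, ψ (f x) = φ x + ((φ x 0) ^ 2 - φ x 0) •
      EuclideanSpace.single (0 : Fin 4) (1 : ℝ))
    {x₀ : M} (hx₀ : x₀ ∈ φ.source) (h0 : φ x₀ 0 = 0) :
    fderiv ℝ (fun y => pfaffian ((stdSymplecticMForm.pullback (𝓡 4) f).inChart x₀ y))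
      (extChartAt (𝓡 4) x₀ x₀) ≠ 0 := by
  have hn : (∞ : ℕ∞ω) ≠ 0 := by simp
  set c := extChartAt (𝓡 4) x₀ x₀ with hc_def
  set σ := extChartAt (𝓡 4) x₀ with hσ
  -- the base point read back through the chart (equal to `x₀`)
  set x₁ : M := σ.symm c with hx₁_def
  have hx₁ : x₁ = x₀ := extChartAt_to_inv x₀
  have hx₁s : x₁ ∈ φ.source := by rw [hx₁]; exact hx₀
  have h0' : φ x₁ 0 = 0 := by rw [hx₁]; exact h0
  -- the fold model, the target chart inverse, the transition map
  set F : EuclideanSpace ℝ (Fin 4) → EuclideanSpace ℝ (Fin 4) := fun u =>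
    u + ((u 0) ^ 2 - u 0) • EuclideanSpace.single (0 : Fin 4) (1 : ℝ) with hF
  set α : EuclideanSpace ℝ (Fin 4) → EuclideanSpace ℝ (Fin 4) := ⇑ψ.symm with hα
  set β : EuclideanSpace ℝ (Fin 4) → EuclideanSpace ℝ (Fin 4) := fun y => φ (σ.symm y) with hβ
  set S : Set (EuclideanSpace ℝ (Fin 4)) := σ.target ∩ σ.symm ⁻¹' φ.source with hS
  have hSo : IsOpen S :=
    (continuousOn_extChartAt_symm x₀).isOpen_inter_preimage (isOpen_extChartAt_target x₀)
      φ.open_source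
  have hcS : c ∈ S := ⟨mem_extChartAt_target x₀, hx₁s⟩
  have hSn : S ∈ 𝓝 c := hSo.mem_nhds hcS
  -- smoothness of the pieces
  have hψs' : ContDiffOn ℝ ∞ α ψ.target :=
    contMDiffOn_iff_contDiffOn.1 (contMDiffOn_symm_of_mem_maximalAtlas hψ)
  have hFs : ContDiff ℝ ∞ F := by
    have h1 : ContDiff ℝ ∞ fun u : EuclideanSpace ℝ (Fin 4) => u 0 := contDiff_piLp_apply (p := 2)
    exact contDiff_id.add (((h1.pow 2).sub h1).smul contDiff_const)
  have hβs : ContDiffOn ℝ ∞ β S := by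
    have h1 : ContMDiffOn 𝓘(ℝ, EuclideanSpace ℝ (Fin 4)) (𝓡 4) ∞ σ.symm σ.target :=
      contMDiffOn_extChartAt_symm x₀
    have h2 : ContMDiffOn (𝓡 4) (𝓡 4) ∞ φ φ.source := contMDiffOn_of_mem_maximalAtlas hφ
    have h3 := h2.comp (h1.mono inter_subset_left) (fun y hy => hy.2)
    exact contMDiffOn_iff_contDiffOn.1 h3
  have hβd : ∀ y ∈ S, DifferentiableAt ℝ β y := fun y hy =>
    (hβs.contDiffAt (hSo.mem_nhds hy)).differentiableAt (by simp)
  have hFβ : ∀ y ∈ S, F (β y) = ψ (f (σ.symm y)) := fun y hy => (hnf _ hy.2).symm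
  have hFβt : ∀ y ∈ S, F (β y) ∈ ψ.target := fun y hy => by
    rw [hFβ y hy]; exact ψ.map_source (hsrc hy.2)
  have hαd : ∀ y ∈ S, DifferentiableAt ℝ α (F (β y)) := fun y hy =>
    (hψs'.contDiffAt (ψ.open_target.mem_nhds (hFβt y hy))).differentiableAt (by simp)
  -- the written map `g = f ∘ σ⁻¹` is `α ∘ F ∘ β` on `S`
  set g : EuclideanSpace ℝ (Fin 4) → EuclideanSpace ℝ (Fin 4) :=
    writtenInExtChartAt (𝓡 4) (𝓡 4) x₀ f with hg
  have hgS : ∀ y ∈ S, g y = α (F (β y)) := by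
    intro y hy
    have h1 : g y = f (σ.symm y) := by simp [hg, writtenInExtChartAt, hσ]
    rw [h1, hFβ y hy, hα, ψ.left_inv (hsrc hy.2)]
  have hDg : ∀ y ∈ S, fderiv ℝ g y =
      (fderiv ℝ α (F (β y))).comp ((fderiv ℝ F (β y)).comp (fderiv ℝ β y)) := by
    intro y hy
    have hev : g =ᶠ[𝓝 y] fun y => α (F (β y)) := by
      filter_upwards [hSo.mem_nhds hy] with z hz
      exact hgS z hz
    rw [hev.fderiv_eq]
    have h1 : DifferentiableAt ℝ (fun y => F (β y)) y :=
      (hFs.differentiable (by simp) _).comp y (hβd y hy)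
    rw [show (fun y => α (F (β y))) = α ∘ (fun y => F (β y)) from rfl,
      fderiv_comp y (hαd y hy) h1,
      show (fun y => F (β y)) = F ∘ β from rfl,
      fderiv_comp y (hFs.differentiable (by simp) _) (hβd y hy)]
  -- the Pfaffian of the chart representative is `det Dg` near the centre
  have hev0 := stdSymplecticMForm.inChart_pullback_eventuallyEq (I := 𝓡 4) (I' := 𝓡 4) (f := f)
    (x := x₀) (Filter.Eventually.of_forall fun z => (hf z).mdifferentiableAt hn)
  have hP : (fun y => pfaffian ((stdSymplecticMForm.pullback (𝓡 4) f).inChart x₀ y)) =ᶠ[𝓝 c]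
      fun y => (fderiv ℝ g y).det := by
    have h2 := hev0
    rw [ModelWithCorners.range_eq_univ, nhdsWithin_univ] at h2
    filter_upwards [h2] with y hy
    rw [hy, fderivWithin_univ, inChart_stdSymplecticMForm]
    show pfaffian (stdSymplecticAlt.compContinuousLinearMap (fderiv ℝ g y)) = _
    rw [pfaffian_compContinuousLinearMap, pfaffian_stdSymplecticAlt, mul_one]
  -- `det Dg = K · Q` near the centre, `Q = u₀ ∘ β`
  set K : EuclideanSpace ℝ (Fin 4) → ℝ := fun y =>
    2 * (fderiv ℝ α (F (β y))).det * (fderiv ℝ β y).det with hK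
  set Q : EuclideanSpace ℝ (Fin 4) → ℝ := fun y => β y 0 with hQ
  have hKQ : (fun y => (fderiv ℝ g y).det) =ᶠ[𝓝 c] fun y => K y * Q y := by
    filter_upwards [hSn] with y hy
    have hTF : fderiv ℝ F (β y) = ContinuousLinearMap.id ℝ (EuclideanSpace ℝ (Fin 4)) +
        ((2 * β y 0 - 1) • (EuclideanSpace.proj (0 : Fin 4) : EuclideanSpace ℝ (Fin 4) →L[ℝ] ℝ)).smulRight
          (EuclideanSpace.single (0 : Fin 4) (1 : ℝ)) := (hasFDerivAt_foldModel (β y)).fderiv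
    rw [hDg y hy, det_comp_clm, det_comp_clm, hTF]
    have hdT := det_foldModelDeriv (β y)
    simp only [hK, hQ, ContinuousLinearMap.det] at hdT ⊢
    rw [hdT]
    ring
  rw [(hP.trans hKQ).fderiv_eq]
  -- `Q` vanishes at the centre and has derivative `du₀ ∘ Dβ`; `K` is continuous and `K c ≠ 0`
  have hQ0 : Q c = 0 := h0'
  have hQd : HasFDerivAt Q ((EuclideanSpace.proj (0 : Fin 4) : EuclideanSpace ℝ (Fin 4) →L[ℝ] ℝ).comp
      (fderiv ℝ β c)) c :=
    (EuclideanSpace.proj (0 : Fin 4) : EuclideanSpace ℝ (Fin 4) →L[ℝ] ℝ).hasFDerivAt.comp c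
      (hβd c hcS).hasFDerivAt
  have hKc : ContinuousAt K c := by
    have h1 : ContinuousAt (fun y => fderiv ℝ β y) c :=
      (hβs.continuousOn_fderiv_of_isOpen hSo (by simp)).continuousAt hSn
    have h2 : ContinuousAt (fun y => fderiv ℝ α (F (β y))) c := by
      have h3 : ContinuousOn (fderiv ℝ α) ψ.target :=
        hψs'.continuousOn_fderiv_of_isOpen ψ.open_target (by simp)
      have h4 : ContinuousAt (fun y => F (β y)) c :=
        hFs.continuous.continuousAt.comp (hβd c hcS).continuousAt
      exact ContinuousAt.comp (g := fderiv ℝ α) (f := fun y => F (β y))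
        (h3.continuousAt (ψ.open_target.mem_nhds (hFβt c hcS))) h4
    have hdet : Continuous fun A : EuclideanSpace ℝ (Fin 4) →L[ℝ] EuclideanSpace ℝ (Fin 4) => A.det :=
      ContinuousLinearMap.continuous_det
    exact (continuousAt_const.mul (hdet.continuousAt.comp h2)).mul (hdet.continuousAt.comp h1)
  -- `Dβ(c) = dφ_{x₁} ∘ D(σ⁻¹)(c)` is invertible
  have hσd : MDifferentiableAt 𝓘(ℝ, EuclideanSpace ℝ (Fin 4)) (𝓡 4) σ.symm c := by
    have h := mdifferentiableWithinAt_extChartAt_symm (I := 𝓡 4) (mem_extChartAt_target x₀)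
    rwa [ModelWithCorners.range_eq_univ, mdifferentiableWithinAt_univ] at h
  have hmd := mdifferentiable_of_mem_maximalAtlas' hφ
  set L₁ := hmd.mfderiv hx₁s with hL₁
  obtain ⟨L₂, hL₂⟩ := isInvertible_mfderivWithin_extChartAt_symm (I := 𝓡 4) (mem_extChartAt_target x₀)
  have hL₂' : ∀ w, L₂ w = mfderiv 𝓘(ℝ, EuclideanSpace ℝ (Fin 4)) (𝓡 4) σ.symm c w := fun w => by
    have h1 := congrArg (fun T => T w) hL₂
    rw [ModelWithCorners.range_eq_univ, mfderivWithin_univ] at h1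
    exact h1
  have hβfd : fderiv ℝ β c = (mfderiv (𝓡 4) (𝓡 4) φ x₁ : EuclideanSpace ℝ (Fin 4) →L[ℝ]
      EuclideanSpace ℝ (Fin 4)).comp (mfderiv 𝓘(ℝ, EuclideanSpace ℝ (Fin 4)) (𝓡 4) σ.symm c) := by
    rw [← mfderiv_eq_fderiv]
    exact mfderiv_comp c (hmd.mdifferentiableAt hx₁s) hσd
  have hβapp : ∀ w, fderiv ℝ β c w = L₁ (L₂ w) := fun w =>
    calc fderiv ℝ β c w = mfderiv (𝓡 4) (𝓡 4) φ x₁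
          (mfderiv 𝓘(ℝ, EuclideanSpace ℝ (Fin 4)) (𝓡 4) σ.symm c w) := congrArg (fun T => T w) hβfd
      _ = L₁ (L₂ w) := by rw [← hL₂' w]; rfl
  have hβeq : fderiv ℝ β c = (L₁ : TangentSpace (𝓡 4) x₁ →L[ℝ] TangentSpace (𝓡 4) (φ x₁)).comp
      (L₂ : TangentSpace (𝓡 4) c →L[ℝ] TangentSpace (𝓡 4) (σ.symm c)) := by
    ext1 w
    exact hβapp w
  have hβdet : (fderiv ℝ β c).det ≠ 0 := by
    have h1 : (fderiv ℝ β c).det = LinearMap.det (L₁.toLinearEquiv : TangentSpace (𝓡 4) x₁ →ₗ[ℝ]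
        TangentSpace (𝓡 4) (φ x₁)) * LinearMap.det (L₂.toLinearEquiv :
          TangentSpace (𝓡 4) c →ₗ[ℝ] TangentSpace (𝓡 4) (σ.symm c)) := by
      rw [hβeq]
      exact LinearMap.det_comp (L₁.toLinearEquiv : TangentSpace (𝓡 4) x₁ →ₗ[ℝ]
        TangentSpace (𝓡 4) (φ x₁)) (L₂.toLinearEquiv : TangentSpace (𝓡 4) c →ₗ[ℝ]
          TangentSpace (𝓡 4) (σ.symm c))
    rw [h1]
    exact mul_ne_zero L₁.toLinearEquiv.isUnit_det'.ne_zero L₂.toLinearEquiv.isUnit_det'.ne_zero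
  have hβsurj : ∀ u, ∃ w, fderiv ℝ β c w = u := fun u =>
    ⟨L₂.symm (L₁.symm u), by rw [hβapp, L₂.apply_symm_apply, L₁.apply_symm_apply]⟩
  have hKc0 : K c ≠ 0 := by
    have h1 : (fderiv ℝ α (F (β c))).det ≠ 0 := by
      rw [hFβ c hcS]
      exact (det_fderiv_symm_ne_zero_of_mem_maximalAtlas hψ (hsrc hx₁s)).1
    exact mul_ne_zero (mul_ne_zero two_ne_zero h1) hβdet
  -- conclusion: the derivative at the centre is `K c • du₀ ∘ Dβ(c) ≠ 0`
  have hG : HasFDerivAt (fun y => K y * Q y)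
      (K c • (EuclideanSpace.proj (0 : Fin 4) : EuclideanSpace ℝ (Fin 4) →L[ℝ] ℝ).comp (fderiv ℝ β c)) c :=
    hasFDerivAt_mul_of_continuousAt_of_eq_zero hKc hQd hQ0
  rw [hG.fderiv]
  intro hzero
  rcases smul_eq_zero.1 hzero with h | h
  · exact hKc0 h
  · obtain ⟨w, hw⟩ := hβsurj (EuclideanSpace.single (0 : Fin 4) (1 : ℝ))
    have h1 := congrArg (fun T : EuclideanSpace ℝ (Fin 4) →L[ℝ] ℝ => T w) h
    simp [hw] at h1

/-! ### Assembly -/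

/-- **The pull-back of `ω₀` by a map folding along a chart 3-sphere is a folded symplectic form**
(Cannas da Silva 2010, §1 / Lemma 4 with the trivial foliation; Gromov 1986, §2.1.3), in the
tree's vocabulary. Data: `e : ℝ⁴ → M` smooth, a topological embedding with injective
differential (so `n ↦ e n` embeds `S³`); `f : M → ℝ⁴` smooth, with injective differential off
`Z = e(S³)` ("regular off `Z`"), and near each point of `Z` charts `φ` of `M`, `ψ` of `ℝ⁴`
(maximal `C^∞` atlases) with `ψ ∘ f = F ∘ φ` for the fold model `F(u) = u + (u₀² - u₀) e₀`
(`= (u₀², u₁, u₂, u₃)`) and `Z = {u₀ = 0}` in `φ`. Conclusion: `f^*ω₀` is smooth and closed,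
its degeneracy locus is exactly `Z`, `ω ∧ ω ⋔ 0` there, and its kernel on `Z` is not tangent to
`Z`. [cite: Cannasdasilva2010, §1 and Lemma 4] -/
theorem isFoldedForm_pullback_of_foldMap [T2Space M]
    {e : EuclideanSpace ℝ (Fin 4) → M} {f : M → EuclideanSpace ℝ (Fin 4)}
    (he : ContMDiff (𝓡 4) (𝓡 4) ∞ e) (heemb : Topology.IsEmbedding e)
    (hde : ∀ y, Injective (mfderiv (𝓡 4) (𝓡 4) e y))
    (hf : ContMDiff (𝓡 4) (𝓡 4) ∞ f)
    (hreg : ∀ x, x ∉ range (fun n : sphere (0 : EuclideanSpace ℝ (Fin 4)) 1 => e n) →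
      Injective (mfderiv (𝓡 4) (𝓡 4) f x))
    (hfold : ∀ n : sphere (0 : EuclideanSpace ℝ (Fin 4)) 1,
      ∃ (φ : OpenPartialHomeomorph M (EuclideanSpace ℝ (Fin 4)))
        (ψ : OpenPartialHomeomorph (EuclideanSpace ℝ (Fin 4)) (EuclideanSpace ℝ (Fin 4))),
        e n ∈ φ.source ∧ φ ∈ IsManifold.maximalAtlas (𝓡 4) ∞ M ∧
        ψ ∈ IsManifold.maximalAtlas (𝓡 4) ∞ (EuclideanSpace ℝ (Fin 4)) ∧
        φ.source ⊆ f ⁻¹' ψ.source ∧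
        (∀ x ∈ φ.source, ψ (f x) = φ x + ((φ x 0) ^ 2 - φ x 0) •
          EuclideanSpace.single (0 : Fin 4) (1 : ℝ)) ∧
        (∀ x ∈ φ.source, x ∈ range (fun n : sphere (0 : EuclideanSpace ℝ (Fin 4)) 1 => e n) ↔
          φ x 0 = 0)) :
    IsFoldedForm (stdSymplecticMForm.pullback (𝓡 4) f) (sphere (0 : EuclideanSpace ℝ (Fin 4)) 1)
      (fun n => e n) := by
  haveI : Fact (Module.finrank ℝ (EuclideanSpace ℝ (Fin 4)) = 3 + 1) := ⟨finrank_euclideanSpace_fin⟩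
  have hn : (∞ : ℕ∞ω) ≠ 0 := by simp
  -- the degeneracy locus is `Z = e(S³)`
  have hfoldZ : fold (stdSymplecticMForm.pullback (𝓡 4) f) =
      range (fun n : sphere (0 : EuclideanSpace ℝ (Fin 4)) 1 => e n) := by
    ext x
    constructor
    · rintro ⟨v, hv, hker⟩
      by_contra hxZ
      have hinj := hreg x hxZ
      have hdeg : ∃ v : EuclideanSpace ℝ (Fin 4), v ≠ 0 ∧ ∀ w : EuclideanSpace ℝ (Fin 4),
          stdSymplecticAlt ![(mfderiv (𝓡 4) (𝓡 4) f x : EuclideanSpace ℝ (Fin 4) →L[ℝ]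
            EuclideanSpace ℝ (Fin 4)) v, (mfderiv (𝓡 4) (𝓡 4) f x : EuclideanSpace ℝ (Fin 4) →L[ℝ]
              EuclideanSpace ℝ (Fin 4)) w] = 0 := by
        refine ⟨v, hv, fun w => ?_⟩
        have h := hker w
        rw [stdSymplecticMForm_pullback_apply] at h
        rw [stdSymplecticAlt_apply]
        exact h
      exact (exists_degenerate_comp_iff_not_injective _).1 hdeg hinj
    · rintro ⟨n, rfl⟩
      obtain ⟨φ, ψ, hmem, hφ, hψ, hsrc, hnf, hZ⟩ := hfold n
      have h0 : φ (e n) 0 = 0 := (hZ _ hmem).1 ⟨n, rfl⟩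
      obtain ⟨v, hv, -, -, hker⟩ := exists_kernel_of_foldChart hφ hψ hsrc hnf hmem h0
      exact ⟨v, hv, hker⟩
  refine ⟨?_, ?_, ?_, ?_, ?_, ?_⟩
  · -- smooth
    exact isSmoothForm_stdSymplecticMForm_pullback hf
  · -- closed
    exact isClosedForm_stdSymplecticMForm_pullback hf
  · -- the folding hypersurface `n ↦ e n` is a smooth embedding of `S³`
    have hval : ContMDiff (𝓡 3) (𝓡 4) ∞
        (Subtype.val : sphere (0 : EuclideanSpace ℝ (Fin 4)) 1 → EuclideanSpace ℝ (Fin 4)) :=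
      contMDiff_coe_sphere
    have hj : ContMDiff (𝓡 3) (𝓡 4) ∞ (fun n : sphere (0 : EuclideanSpace ℝ (Fin 4)) 1 => e n) :=
      he.comp hval
    have hjinj : Injective (fun n : sphere (0 : EuclideanSpace ℝ (Fin 4)) 1 => e n) :=
      heemb.injective.comp Subtype.val_injective
    have hjd : ∀ n, Injective (mfderiv (𝓡 3) (𝓡 4)
        (fun n : sphere (0 : EuclideanSpace ℝ (Fin 4)) 1 => e n) n) := by
      intro n
      have hc := mfderiv_comp n ((he n).mdifferentiableAt hn) ((hval n).mdifferentiableAt hn)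
      have hc' : ∀ u, mfderiv (𝓡 3) (𝓡 4) (fun n : sphere (0 : EuclideanSpace ℝ (Fin 4)) 1 => e n) n u
          = mfderiv (𝓡 4) (𝓡 4) e n (mfderiv (𝓡 3) (𝓡 4) Subtype.val n u) := fun u =>
        congrArg (fun T => T u) hc
      intro a b hab
      rw [hc', hc'] at hab
      exact mfderiv_coe_sphere_injective n (hde _ hab)
    exact Literature.Topology.FourManifolds.isSmoothEmbedding_of_injective_of_injective_mfderiv hj
      (by simp) hjinj hjd
  · -- range = fold
    exact hfoldZ.symm
  · -- transversality of `ω ∧ ω`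
    intro x₀ hx₀
    rw [hfoldZ] at hx₀
    obtain ⟨n, rfl⟩ := hx₀
    obtain ⟨φ, ψ, hmem, hφ, hψ, hsrc, hnf, hZ⟩ := hfold n
    have h0 : φ (e n) 0 = 0 := (hZ _ hmem).1 ⟨n, rfl⟩
    exact fderiv_pfaffian_inChart_ne_zero_of_foldChart hf hφ hψ hsrc hnf hmem h0
  · -- maximal rank: the kernel direction `∂/∂u₀` is not tangent to `Z = {u₀ = 0}`
    intro n
    obtain ⟨φ, ψ, hmem, hφ, hψ, hsrc, hnf, hZ⟩ := hfold n
    have h0 : φ (e n) 0 = 0 := (hZ _ hmem).1 ⟨n, rfl⟩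
    obtain ⟨v, hv, hφv, -, hker⟩ := exists_kernel_of_foldChart hφ hψ hsrc hnf hmem h0
    refine ⟨v, hker, ?_⟩
    rintro ⟨w, hw⟩
    -- `u₀ ∘ φ ∘ e` vanishes identically on `S³` near `n`
    set q : sphere (0 : EuclideanSpace ℝ (Fin 4)) 1 → ℝ := fun n' => φ (e n') 0 with hq
    have hval : ContMDiff (𝓡 3) (𝓡 4) ∞
        (Subtype.val : sphere (0 : EuclideanSpace ℝ (Fin 4)) 1 → EuclideanSpace ℝ (Fin 4)) :=
      contMDiff_coe_sphere
    have hj : ContMDiff (𝓡 3) (𝓡 4) ∞ (fun n : sphere (0 : EuclideanSpace ℝ (Fin 4)) 1 => e n) :=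
      he.comp hval
    have hq0 : q =ᶠ[𝓝 n] fun _ => (0 : ℝ) := by
      have ho : IsOpen {n' : sphere (0 : EuclideanSpace ℝ (Fin 4)) 1 | e n' ∈ φ.source} :=
        φ.open_source.preimage hj.continuous
      filter_upwards [ho.mem_nhds hmem] with n' hn'
      exact (hZ _ hn').1 ⟨n', rfl⟩
    have hdq0 : mfderiv (𝓡 3) 𝓘(ℝ, ℝ) q n = 0 := by
      rw [hq0.mfderiv_eq]
      exact mfderiv_const
    -- but by the chain rule `dq_n w = u₀ (dφ (d(e∘ι) w)) = u₀ (dφ v) = u₀ (e₀) = 1`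
    have hmd := mdifferentiable_of_mem_maximalAtlas' hφ
    have hP0 : MDifferentiableAt (𝓡 4) 𝓘(ℝ, ℝ)
        (fun u : EuclideanSpace ℝ (Fin 4) => (EuclideanSpace.proj (0 : Fin 4) :
          EuclideanSpace ℝ (Fin 4) →L[ℝ] ℝ) u) (φ (e n)) :=
      (EuclideanSpace.proj (0 : Fin 4) : EuclideanSpace ℝ (Fin 4) →L[ℝ] ℝ).contMDiff.mdifferentiableAt
        (n := ∞) hn
    have hφj : MDifferentiableAt (𝓡 3) (𝓡 4)
        (fun n' : sphere (0 : EuclideanSpace ℝ (Fin 4)) 1 => φ (e n')) n :=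
      (hmd.mdifferentiableAt hmem).comp n ((hj n).mdifferentiableAt hn)
    have hc1 : mfderiv (𝓡 3) 𝓘(ℝ, ℝ) q n =
        (mfderiv (𝓡 4) 𝓘(ℝ, ℝ) (fun u : EuclideanSpace ℝ (Fin 4) =>
          (EuclideanSpace.proj (0 : Fin 4) : EuclideanSpace ℝ (Fin 4) →L[ℝ] ℝ) u) (φ (e n))).comp
          (mfderiv (𝓡 3) (𝓡 4) (fun n' : sphere (0 : EuclideanSpace ℝ (Fin 4)) 1 => φ (e n')) n) :=
      mfderiv_comp n hP0 hφj
    have hc2 : mfderiv (𝓡 3) (𝓡 4) (fun n' : sphere (0 : EuclideanSpace ℝ (Fin 4)) 1 => φ (e n')) n =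
        (mfderiv (𝓡 4) (𝓡 4) φ (e n)).comp
          (mfderiv (𝓡 3) (𝓡 4) (fun n' : sphere (0 : EuclideanSpace ℝ (Fin 4)) 1 => e n') n) :=
      mfderiv_comp n (hmd.mdifferentiableAt hmem) ((hj n).mdifferentiableAt hn)
    have hc3 : mfderiv (𝓡 4) 𝓘(ℝ, ℝ) (fun u : EuclideanSpace ℝ (Fin 4) =>
        (EuclideanSpace.proj (0 : Fin 4) : EuclideanSpace ℝ (Fin 4) →L[ℝ] ℝ) u) (φ (e n)) =
          (EuclideanSpace.proj (0 : Fin 4) : EuclideanSpace ℝ (Fin 4) →L[ℝ] ℝ) :=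
      ContinuousLinearMap.mfderiv_eq _
    have hc1' : ∀ u, mfderiv (𝓡 3) 𝓘(ℝ, ℝ) q n u =
        mfderiv (𝓡 4) 𝓘(ℝ, ℝ) (fun u : EuclideanSpace ℝ (Fin 4) =>
          (EuclideanSpace.proj (0 : Fin 4) : EuclideanSpace ℝ (Fin 4) →L[ℝ] ℝ) u) (φ (e n))
          (mfderiv (𝓡 3) (𝓡 4) (fun n' : sphere (0 : EuclideanSpace ℝ (Fin 4)) 1 => φ (e n')) n u) :=
      fun u => congrArg (fun T => T u) hc1
    have hc2' : ∀ u, mfderiv (𝓡 3) (𝓡 4) (fun n' : sphere (0 : EuclideanSpace ℝ (Fin 4)) 1 =>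
        φ (e n')) n u = mfderiv (𝓡 4) (𝓡 4) φ (e n)
          (mfderiv (𝓡 3) (𝓡 4) (fun n' : sphere (0 : EuclideanSpace ℝ (Fin 4)) 1 => e n') n u) :=
      fun u => congrArg (fun T => T u) hc2
    have hc3' : ∀ z : EuclideanSpace ℝ (Fin 4), mfderiv (𝓡 4) 𝓘(ℝ, ℝ)
        (fun u : EuclideanSpace ℝ (Fin 4) => (EuclideanSpace.proj (0 : Fin 4) :
          EuclideanSpace ℝ (Fin 4) →L[ℝ] ℝ) u) (φ (e n)) z = z 0 := fun z => by
      rw [hc3]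
      rfl
    have hzero : mfderiv (𝓡 3) 𝓘(ℝ, ℝ) q n w = (0 : ℝ) := by
      rw [hdq0]
      rfl
    have hone : mfderiv (𝓡 3) 𝓘(ℝ, ℝ) q n w = (1 : ℝ) := by
      rw [hc1', hc2', hw, hφv, hc3']
      simp
    have h10 : (1 : ℝ) = 0 := hone.symm.trans hzero
    exact one_ne_zero h10

end Summit.SmoothPoincare4.SmoothPoincare4.Theorems.FoldedSphereFoldExistence

end
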